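import Mathlib
import Summits.Ventures.PercRepro2.Defs
import Summits.Ventures.PercRepro2.Harris
import Summits.Ventures.PercRepro2.Graph
import Summits.Ventures.PercRepro2.Events
import Summits.Ventures.PercRepro2.TReduction
import Summits.Ventures.PercRepro2.TReductionBase
import Summits.Ventures.PercRepro2.THBaseEnum
import Summits.Ventures.PercRepro2.THClassVEnum
import Summits.Ventures.PercRepro2.THClassIIGraph
import Summits.Ventures.PercRepro2.THClassIIP3Enum

/-!
# Slice A of the base-case census of the class-(ii) graph `G₂` (mine-a g51)

The pinning patterns with `s0 = 0` (the edge `r x₂` closed), split by the state of `r x₃`.  Every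
    lemma is a kernel evaluation (`decide +kernel`) of `THClassIIP3.enum` over all
patterns of the remaining edges: the antipodal base case of the class-(ii) graph `G₂` at the pair
`({x₃, x₄, x₅, x₆ ∈ T} ∪ {h, x₃, x₄, x₅ ∈ T}, {x₆ ∈ T})` is nonnegative at every proper pinning in
    this slice.  Together
(`THClassIIP3.enum_nonneg`) the slices cover every pattern other than «every edge free».
No instance, no notation.
-/

namespace Summit.Ventures.PercRepro2

namespace THClassIIP3

set_option maxHeartbeats 0 in
/-- `r x₂` in state `0`, `r x₃` in state `0`: `65536` leaves. -/
lemma slice_00 : ∀ s2 s3 s4 s5 s6 s7 s8 s9 : Fin 3, 0 ≤ enum 0 0 s2 s3 s4 s5 s6 s7 s8 s9 := by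
  decide +kernel

set_option maxHeartbeats 0 in
/-- `r x₂` in state `0`, `r x₃` in state `1`: `65536` leaves. -/
lemma slice_01 : ∀ s2 s3 s4 s5 s6 s7 s8 s9 : Fin 3, 0 ≤ enum 0 1 s2 s3 s4 s5 s6 s7 s8 s9 := by
  decide +kernel

set_option maxHeartbeats 0 in
/-- `r x₂` in state `0`, `r x₃` in state `2`: `131072` leaves. -/
lemma slice_02 : ∀ s2 s3 s4 s5 s6 s7 s8 s9 : Fin 3, 0 ≤ enum 0 2 s2 s3 s4 s5 s6 s7 s8 s9 := by
  decide +kernel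


end THClassIIP3

end Summit.Ventures.PercRepro2
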